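import Mathlib
import Summits.ValiantsHypothesis.ValiantsHypothesis.Theorems.RigidityForcesSymmetryRankRigidMinimalReprLaplaceResidualFullSupport

/-!
# CASE 2 of the `a = 3` residual blueprint for `LaplaceOptimal 5`: the kernel of the triple-permanent map when `φ₀` vanishes
# at ONE letter (crux `RankRigidMinimalRepr`, stmt-ValiantsHypothesis-18034; frontier rung `LaplaceOptimalFive`, stmt-24813)

Companion of LEMMA Z (`…LaplaceResidualSupportLemma`, val-port-2; `…LaplaceResidualFullSupport`): there `φ₀` has FULL support and
the ten `3 × 3` permanents of `(φ₀; φ₁; φ₂)` determine the ten `2 × 2` permanents of `(φ₁; φ₂)` (they all vanish).  In CASE 2 of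
val-lit-p8 g11's plan (evidence note `NOTE-p8g11-24813-a3-class-residual4.md` §v3 on stmt-24813: the slice at slot `0` is a
letter-indicator `κ·e_a`, so the dual covector `φ₀` has `φ₀(a) = 0` and, at best, full support OFF `a`) the annihilator
`Ann₂(Σ_{c≠a} y_c)` is the 2-dimensional space of matching patterns, and what the blueprint needs is control of the KERNEL
`{φ₂ : all 3 × 3 permanents of (φ₀; φ₁; φ₂) vanish}` for suitable `φ₁`:

* `pairPerm_through_eq_zero` — the pairs THROUGH `a` still vanish: `φ₁(a)φ₂(x) + φ₁(x)φ₂(a) = 0` for `x ≠ a`;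
* `matching_pattern` — off `a`, complementary pairs are tied: `φ₀(d)φ₀(e)·P(b,c) = φ₀(b)φ₀(c)·P(d,e)`;
* `kernel_of_apply_ne_zero` (K1) — if `φ₁(a) ≠ 0` the kernel is a LINE: `φ₂ = κ·(−φ₁(a) e_a + Σ_{x≠a} φ₁(x) e_x)`;
* `kernel_of_two_letters` (K2a) — if `φ₁` is supported on two letters `b, c ≠ a` with `φ₀(c)φ₁(b) + φ₀(b)φ₁(c) ≠ 0` (the
  normalised pattern `(s,t,0,0)` with `s ≠ −t`), the kernel lies in the line `{φ₂ ⊆ {b,c}, P(b,c) = 0}`;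
* `kernel_of_balanced` (K2b) — if `φ₁ = (φ₀(b), φ₀(c), −φ₀(d), −φ₀(e))` off `a` (normalised pattern `(1,1,−1,−1)`) and
  `φ₁(a) = 0`, the kernel is `0`.
These are the «explicit 4 × 4 ranks» of the memo's Case 2 (checked there in exact arithmetic; here in the kernel by
`linear_combination`).  Conventions verbatim those of LEMMA Z: `P(a,b) = φ₁ a φ₂ b + φ₁ b φ₂ a`,
`per₃(a,b,c) = φ₀ a·P(b,c) + φ₀ b·P(a,c) + φ₀ c·P(a,b)`; no definitions.  Seat val-lit-p3 g14 (second hand under val-port-2's cut,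
val-lit desk RULING #260 (c)).

HONEST FRAMING: elementary linear algebra toward the frontier rung `LaplaceOptimalFive` (stmt-24813), which stays OPEN (as do
24814 / 18034); nothing here bears on `VP ≠ VNP`, which is NOT proved.
-/

set_option autoImplicit false

-- the mandated summit-side namespace repeats a component by design (single-problem summit)
set_option linter.dupNamespace false

namespace Summit.ValiantsHypothesis.ValiantsHypothesis.Theorems.RigidityForcesSymmetryRankRigidMinimalRepr

namespace LaplaceResidual

open Finset

/-! ### §1 Pairs through the dark letter vanish -/

/-- **Pairs through `a`.**  If `φ₀(a) = 0`, `φ₀(c) ≠ 0` for `c ≠ a`, and all `3 × 3` permanents of `(φ₀; φ₁; φ₂)` vanish, then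
`P(a,x) = φ₁(a)φ₂(x) + φ₁(x)φ₂(a) = 0` for every `x ≠ a` (three triples through `a` give `2 φ₀(y)φ₀(w)·P(a,x) = 0`). [folklore] -/
theorem pairPerm_through_eq_zero (φ₀ φ₁ φ₂ : Fin 5 → ℂ) (a : Fin 5) (ha : φ₀ a = 0) (h0 : ∀ c, c ≠ a → φ₀ c ≠ 0)
    (hper : ∀ x y z : Fin 5, x ≠ y → x ≠ z → y ≠ z →
      φ₀ x * (φ₁ y * φ₂ z + φ₁ z * φ₂ y) + φ₀ y * (φ₁ x * φ₂ z + φ₁ z * φ₂ x) +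
        φ₀ z * (φ₁ x * φ₂ y + φ₁ y * φ₂ x) = 0)
    (x : Fin 5) (hx : x ≠ a) : φ₁ a * φ₂ x + φ₁ x * φ₂ a = 0 := by
  obtain ⟨y, w, -, hya, hyx, hwa, hwx, -, -, hyw, -, -⟩ := exists_three_others a x hx.symm
  have h1 := hper a x y hx.symm hya.symm hyx.symm
  have h2 := hper a x w hx.symm hwa.symm hwx.symm
  have h3 := hper a y w hya.symm hwa.symm hyw
  rw [ha] at h1 h2 h3
  have key : 2 * (φ₀ y * φ₀ w) * (φ₁ a * φ₂ x + φ₁ x * φ₂ a) = 0 := by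
    linear_combination φ₀ w * h1 + φ₀ y * h2 - φ₀ x * h3
  have hne : (2 : ℂ) * (φ₀ y * φ₀ w) ≠ 0 := mul_ne_zero (by norm_num) (mul_ne_zero (h0 y hya) (h0 w hwa))
  rcases mul_eq_zero.1 key with h | h
  · exact absurd h hne
  · exact h

/-- **Matching pattern off `a`.**  For four distinct letters `b, c, d, e` (the triples among them suffice):
`φ₀(d)φ₀(e)·P(b,c) = φ₀(b)φ₀(c)·P(d,e)` — complementary pairs carry tied values. [folklore] -/
theorem matching_pattern (φ₀ φ₁ φ₂ : Fin 5 → ℂ)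
    (hper : ∀ x y z : Fin 5, x ≠ y → x ≠ z → y ≠ z →
      φ₀ x * (φ₁ y * φ₂ z + φ₁ z * φ₂ y) + φ₀ y * (φ₁ x * φ₂ z + φ₁ z * φ₂ x) +
        φ₀ z * (φ₁ x * φ₂ y + φ₁ y * φ₂ x) = 0)
    (b c d e : Fin 5) (hbc : b ≠ c) (hbd : b ≠ d) (hbe : b ≠ e) (hcd : c ≠ d) (hce : c ≠ e) (hde : d ≠ e) :
    φ₀ d * φ₀ e * (φ₁ b * φ₂ c + φ₁ c * φ₂ b) = φ₀ b * φ₀ c * (φ₁ d * φ₂ e + φ₁ e * φ₂ d) := by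
  have h1 := hper b c d hbc hbd hcd
  have h2 := hper b c e hbc hbe hce
  have h3 := hper b d e hbd hbe hde
  have h4 := hper c d e hcd hce hde
  linear_combination (φ₀ e * h1 + φ₀ d * h2 - φ₀ c * h3 - φ₀ b * h4) / 2

/-! ### §2 (K1): `φ₁(a) ≠ 0` — the kernel is a line -/

/-- **(K1)**  `φ₀(a) = 0`, full support off `a`, all `3 × 3` permanents of `(φ₀; φ₁; φ₂)` zero, and `φ₁(a) ≠ 0`: then
`φ₂ = κ·ψ̄` with `ψ̄(a) = −φ₁(a)`, `ψ̄(x) = φ₁(x)` (`x ≠ a`), namely `κ = −φ₂(a)/φ₁(a)` — the solutions form a line. [folklore] -/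
theorem kernel_of_apply_ne_zero (φ₀ φ₁ φ₂ : Fin 5 → ℂ) (a : Fin 5) (ha : φ₀ a = 0) (h0 : ∀ c, c ≠ a → φ₀ c ≠ 0)
    (hper : ∀ x y z : Fin 5, x ≠ y → x ≠ z → y ≠ z →
      φ₀ x * (φ₁ y * φ₂ z + φ₁ z * φ₂ y) + φ₀ y * (φ₁ x * φ₂ z + φ₁ z * φ₂ x) +
        φ₀ z * (φ₁ x * φ₂ y + φ₁ y * φ₂ x) = 0)
    (h1 : φ₁ a ≠ 0) :
    ∃ κ : ℂ, (∀ x, x ≠ a → φ₂ x = κ * φ₁ x) ∧ φ₂ a = -κ * φ₁ a := by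
  refine ⟨-φ₂ a / φ₁ a, fun x hx => ?_, ?_⟩
  · have h := pairPerm_through_eq_zero φ₀ φ₁ φ₂ a ha h0 hper x hx
    field_simp
    linear_combination h
  · field_simp

/-- (K1), uniqueness form: two solutions `φ₂, φ₂'` with `φ₁(a) ≠ 0` are proportional through `a`:
`φ₂'(a)·φ₂ = φ₂(a)·φ₂'`. [folklore] -/
theorem kernel_proportional_of_apply_ne_zero (φ₀ φ₁ φ₂ φ₂' : Fin 5 → ℂ) (a : Fin 5) (ha : φ₀ a = 0)
    (h0 : ∀ c, c ≠ a → φ₀ c ≠ 0)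
    (hper : ∀ x y z : Fin 5, x ≠ y → x ≠ z → y ≠ z →
      φ₀ x * (φ₁ y * φ₂ z + φ₁ z * φ₂ y) + φ₀ y * (φ₁ x * φ₂ z + φ₁ z * φ₂ x) +
        φ₀ z * (φ₁ x * φ₂ y + φ₁ y * φ₂ x) = 0)
    (hper' : ∀ x y z : Fin 5, x ≠ y → x ≠ z → y ≠ z →
      φ₀ x * (φ₁ y * φ₂' z + φ₁ z * φ₂' y) + φ₀ y * (φ₁ x * φ₂' z + φ₁ z * φ₂' x) +
        φ₀ z * (φ₁ x * φ₂' y + φ₁ y * φ₂' x) = 0)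
    (h1 : φ₁ a ≠ 0) : ∀ x, φ₂' a * φ₂ x = φ₂ a * φ₂' x := by
  obtain ⟨κ, hκ, hκa⟩ := kernel_of_apply_ne_zero φ₀ φ₁ φ₂ a ha h0 hper h1
  obtain ⟨κ', hκ', hκa'⟩ := kernel_of_apply_ne_zero φ₀ φ₁ φ₂' a ha h0 hper' h1
  intro x
  by_cases hx : x = a
  · rw [hx]; ring
  · rw [hκ x hx, hκ' x hx, hκa, hκa']; ring

/-! ### §3 (K2a): `φ₁` on two letters with a non-degenerate pattern — the kernel is a line -/

/-- **(K2a)**  `φ₀(a) = 0`, full support off `a`; `φ₁(a) = 0` and `φ₁` supported on `{b, c}` (`b, c ≠ a`, `b ≠ c`) with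
`φ₀(c)φ₁(b) + φ₀(b)φ₁(c) ≠ 0` (normalised pattern `(s,t,0,0)`, `s ≠ −t`).  If all `3 × 3` permanents of `(φ₀; φ₁; φ₂)`
vanish, then `φ₂` vanishes off `{b, c}` and `P(b,c) = φ₁(b)φ₂(c) + φ₁(c)φ₂(b) = 0` — the solutions form the line
`ℂ·(φ₁(b) e_b − φ₁(c) e_c)`. [folklore] -/
theorem kernel_of_two_letters (φ₀ φ₁ φ₂ : Fin 5 → ℂ) (a : Fin 5) (ha : φ₀ a = 0) (h0 : ∀ c, c ≠ a → φ₀ c ≠ 0)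
    (hper : ∀ x y z : Fin 5, x ≠ y → x ≠ z → y ≠ z →
      φ₀ x * (φ₁ y * φ₂ z + φ₁ z * φ₂ y) + φ₀ y * (φ₁ x * φ₂ z + φ₁ z * φ₂ x) +
        φ₀ z * (φ₁ x * φ₂ y + φ₁ y * φ₂ x) = 0)
    (b c : Fin 5) (hba : b ≠ a) (hca : c ≠ a) (hbc : b ≠ c)
    (h1a : φ₁ a = 0) (h1off : ∀ x, x ≠ b → x ≠ c → φ₁ x = 0) (hnd : φ₀ c * φ₁ b + φ₀ b * φ₁ c ≠ 0) :
    (∀ x, x ≠ b → x ≠ c → φ₂ x = 0) ∧ φ₁ b * φ₂ c + φ₁ c * φ₂ b = 0 := by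
  -- the value at `a`
  have h2a : φ₂ a = 0 := by
    have hb := pairPerm_through_eq_zero φ₀ φ₁ φ₂ a ha h0 hper b hba
    have hc := pairPerm_through_eq_zero φ₀ φ₁ φ₂ a ha h0 hper c hca
    rw [h1a, zero_mul, zero_add] at hb hc
    by_contra hne
    have hb0 : φ₁ b = 0 := (mul_eq_zero.1 hb).resolve_right hne
    have hc0 : φ₁ c = 0 := (mul_eq_zero.1 hc).resolve_right hne
    exact hnd (by rw [hb0, hc0, mul_zero, mul_zero, add_zero])
  have hP : φ₁ b * φ₂ c + φ₁ c * φ₂ b = 0 ∧ ∀ x, x ≠ b → x ≠ c → φ₂ x = 0 := by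
    -- the two letters off `{a,b,c}`
    obtain ⟨d, hd⟩ : ∃ d : Fin 5, d ≠ a ∧ d ≠ b ∧ d ≠ c := by
      obtain ⟨p, q, r, hpa, hpb, hqa, hqb, hra, hrb, hpq, hpr, hqr⟩ := exists_three_others a b hba.symm
      by_cases hpc : p = c
      · exact ⟨q, hqa, hqb, fun h => hpq (hpc.trans h.symm)⟩
      · exact ⟨p, hpa, hpb, hpc⟩
    obtain ⟨e, he⟩ : ∃ e : Fin 5, e ≠ a ∧ e ≠ b ∧ e ≠ c ∧ e ≠ d := by
      obtain ⟨p, q, r, hpa, hpb, hqa, hqb, hra, hrb, hpq, hpr, hqr⟩ := exists_three_others a b hba.symm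
      by_cases hpc : p = c
      · by_cases hqd : q = d
        · exact ⟨r, hra, hrb, fun h => hpr (hpc.trans h.symm), fun h => hqr (hqd.trans h.symm)⟩
        · exact ⟨q, hqa, hqb, fun h => hpq (hpc.trans h.symm), hqd⟩
      · by_cases hpd : p = d
        · by_cases hqc : q = c
          · exact ⟨r, hra, hrb, fun h => hqr (hqc.trans h.symm), fun h => hpr (hpd.trans h.symm)⟩
          · by_cases hqd : q = d
            · exact absurd (hpd.trans hqd.symm) hpq
            · exact ⟨q, hqa, hqb, hqc, hqd⟩
        · exact ⟨p, hpa, hpb, hpc, hpd⟩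
    obtain ⟨hda, hdb, hdc⟩ := hd
    obtain ⟨hea, heb, hec, hed⟩ := he
    have h1d : φ₁ d = 0 := h1off d hdb hdc
    have h1e : φ₁ e = 0 := h1off e heb hec
    -- matching pattern on `{b, c, d, e}`: `P(b,c)` is tied to `P(d,e) = 0`
    have hm := matching_pattern φ₀ φ₁ φ₂ hper b c d e hbc hdb.symm heb.symm hdc.symm hec.symm hed.symm
    rw [h1d, h1e, zero_mul, zero_mul, add_zero, mul_zero] at hm
    have hPbc : φ₁ b * φ₂ c + φ₁ c * φ₂ b = 0 := by
      rcases mul_eq_zero.1 hm with h | h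
      · rcases mul_eq_zero.1 h with h' | h'
        · exact absurd h' (h0 d hda)
        · exact absurd h' (h0 e hea)
      · exact h
    -- the triples `{b, c, d}` and `{b, c, e}` then kill `φ₂ d`, `φ₂ e`
    have hkill : ∀ f : Fin 5, f ≠ a → f ≠ b → f ≠ c → φ₁ f = 0 → φ₂ f = 0 := by
      intro f hfa hfb hfc h1f
      have h := hper b c f hbc hfb.symm hfc.symm
      rw [h1f, hPbc, zero_mul, add_zero, zero_mul, add_zero, mul_zero, add_zero] at h
      have h' : (φ₀ c * φ₁ b + φ₀ b * φ₁ c) * φ₂ f = 0 := by linear_combination h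
      rcases mul_eq_zero.1 h' with h'' | h''
      · exact absurd h'' hnd
      · exact h''
    refine ⟨hPbc, fun x hxb hxc => ?_⟩
    by_cases hxa : x = a
    · rw [hxa]; exact h2a
    · exact hkill x hxa hxb hxc (h1off x hxb hxc)
  exact ⟨hP.2, hP.1⟩

/-! ### §4 (K2b): the balanced pattern `(1,1,−1,−1)` — the kernel is zero -/

/-- **(K2b)**  `φ₀(a) = 0`, full support off `a`; `b, c, d, e` the four other letters; `φ₁(a) = 0` and
`φ₁ = (φ₀(b), φ₀(c), −φ₀(d), −φ₀(e))` on them (normalised pattern `(1,1,−1,−1)`).  If all `3 × 3` permanents of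
`(φ₀; φ₁; φ₂)` vanish, then `φ₂ = 0`. [folklore] -/
theorem kernel_of_balanced (φ₀ φ₁ φ₂ : Fin 5 → ℂ) (a b c d e : Fin 5) (ha : φ₀ a = 0) (h0 : ∀ x, x ≠ a → φ₀ x ≠ 0)
    (hba : b ≠ a) (hca : c ≠ a) (hda : d ≠ a) (hea : e ≠ a)
    (hbc : b ≠ c) (hbd : b ≠ d) (hbe : b ≠ e) (hcd : c ≠ d) (hce : c ≠ e) (hde : d ≠ e)
    (hper : ∀ x y z : Fin 5, x ≠ y → x ≠ z → y ≠ z →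
      φ₀ x * (φ₁ y * φ₂ z + φ₁ z * φ₂ y) + φ₀ y * (φ₁ x * φ₂ z + φ₁ z * φ₂ x) +
        φ₀ z * (φ₁ x * φ₂ y + φ₁ y * φ₂ x) = 0)
    (h1a : φ₁ a = 0) (h1b : φ₁ b = φ₀ b) (h1c : φ₁ c = φ₀ c) (h1d : φ₁ d = -φ₀ d) (h1e : φ₁ e = -φ₀ e) :
    ∀ x, φ₂ x = 0 := by
  -- the value at `a`
  have h2a : φ₂ a = 0 := by
    have hb := pairPerm_through_eq_zero φ₀ φ₁ φ₂ a ha h0 hper b hba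
    rw [h1a, zero_mul, zero_add, h1b] at hb
    exact (mul_eq_zero.1 hb).resolve_left (h0 b hba)
  -- the four triples off `a`
  have tbcd := hper b c d hbc hbd hcd
  have tbce := hper b c e hbc hbe hce
  have tbde := hper b d e hbd hbe hde
  have tcde := hper c d e hcd hce hde
  rw [h1b, h1c, h1d] at tbcd
  rw [h1b, h1c, h1e] at tbce
  rw [h1b, h1d, h1e] at tbde
  rw [h1c, h1d, h1e] at tcde
  -- `{b,c,d}`: `2 φ₀ b φ₀ c · φ₂ d = 0`; `{b,c,e}`: `2 φ₀ b φ₀ c · φ₂ e = 0`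
  have hd0 : φ₂ d = 0 := by
    have h : 2 * (φ₀ b * φ₀ c) * φ₂ d = 0 := by linear_combination tbcd
    rcases mul_eq_zero.1 h with h' | h'
    · exact absurd h' (mul_ne_zero (by norm_num) (mul_ne_zero (h0 b hba) (h0 c hca)))
    · exact h'
  have he0 : φ₂ e = 0 := by
    have h : 2 * (φ₀ b * φ₀ c) * φ₂ e = 0 := by linear_combination tbce
    rcases mul_eq_zero.1 h with h' | h'
    · exact absurd h' (mul_ne_zero (by norm_num) (mul_ne_zero (h0 b hba) (h0 c hca)))
    · exact h'
  -- `{b,d,e}`: `−2 φ₀ d φ₀ e · φ₂ b = 0`; `{c,d,e}`: `−2 φ₀ d φ₀ e · φ₂ c = 0`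
  have hb0 : φ₂ b = 0 := by
    have h : -2 * (φ₀ d * φ₀ e) * φ₂ b = 0 := by
      rw [hd0, he0] at tbde; linear_combination tbde
    rcases mul_eq_zero.1 h with h' | h'
    · exact absurd h' (mul_ne_zero (by norm_num) (mul_ne_zero (h0 d hda) (h0 e hea)))
    · exact h'
  have hc0 : φ₂ c = 0 := by
    have h : -2 * (φ₀ d * φ₀ e) * φ₂ c = 0 := by
      rw [hd0, he0] at tcde; linear_combination tcde
    rcases mul_eq_zero.1 h with h' | h'
    · exact absurd h' (mul_ne_zero (by norm_num) (mul_ne_zero (h0 d hda) (h0 e hea)))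
    · exact h'
  -- every letter is one of `a, b, c, d, e`
  have hcover : ∀ x : Fin 5, x = a ∨ x = b ∨ x = c ∨ x = d ∨ x = e := by
    have hcard : ({a, b, c, d, e} : Finset (Fin 5)) = Finset.univ := by
      apply Finset.eq_univ_of_card
      rw [Finset.card_insert_of_notMem, Finset.card_insert_of_notMem, Finset.card_insert_of_notMem,
        Finset.card_insert_of_notMem, Finset.card_singleton]
      · rfl
      · simpa using hde
      · simp [hcd, hce]
      · simp [hbc, hbd, hbe]
      · simp [hba.symm, hca.symm, hda.symm, hea.symm]
    intro x
    have hx : x ∈ ({a, b, c, d, e} : Finset (Fin 5)) := by rw [hcard]; exact Finset.mem_univ x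
    simpa [Finset.mem_insert, Finset.mem_singleton] using hx
  intro x
  rcases hcover x with rfl | rfl | rfl | rfl | rfl
  · exact h2a
  · exact hb0
  · exact hc0
  · exact hd0
  · exact he0


/-! ### §5 Line forms (the shape «kernel ⊆ a line» consumed by the image-dimension reduction) -/

/-- (K1) as «kernel ⊆ a line»: with `ω = (−φ₁(a)) e_a + Σ_{x≠a} φ₁(x) e_x`, every solution `φ₂` is `κ·ω`. [folklore] -/
theorem kernel_line_of_apply_ne_zero (φ₀ φ₁ : Fin 5 → ℂ) (a : Fin 5) (ha : φ₀ a = 0) (h0 : ∀ c, c ≠ a → φ₀ c ≠ 0)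
    (h1 : φ₁ a ≠ 0) :
    ∀ φ₂ : Fin 5 → ℂ, (∀ x y z : Fin 5, x ≠ y → x ≠ z → y ≠ z →
      φ₀ x * (φ₁ y * φ₂ z + φ₁ z * φ₂ y) + φ₀ y * (φ₁ x * φ₂ z + φ₁ z * φ₂ x) +
        φ₀ z * (φ₁ x * φ₂ y + φ₁ y * φ₂ x) = 0) →
      ∃ κ : ℂ, ∀ x, φ₂ x = κ * (if x = a then -φ₁ a else φ₁ x) := by
  intro φ₂ hper
  obtain ⟨κ, hκ, hκa⟩ := kernel_of_apply_ne_zero φ₀ φ₁ φ₂ a ha h0 hper h1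
  refine ⟨κ, fun x => ?_⟩
  by_cases hx : x = a
  · rw [if_pos hx, hx, hκa]; ring
  · rw [if_neg hx, hκ x hx]

/-- (K2a) as «kernel ⊆ a line»: with `ω = φ₁(b) e_b − φ₁(c) e_c`, every solution `φ₂` is `κ·ω`. [folklore] -/
theorem kernel_line_of_two_letters (φ₀ φ₁ : Fin 5 → ℂ) (a : Fin 5) (ha : φ₀ a = 0) (h0 : ∀ c, c ≠ a → φ₀ c ≠ 0)
    (b c : Fin 5) (hba : b ≠ a) (hca : c ≠ a) (hbc : b ≠ c)
    (h1a : φ₁ a = 0) (h1off : ∀ x, x ≠ b → x ≠ c → φ₁ x = 0) (hnd : φ₀ c * φ₁ b + φ₀ b * φ₁ c ≠ 0) :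
    ∀ φ₂ : Fin 5 → ℂ, (∀ x y z : Fin 5, x ≠ y → x ≠ z → y ≠ z →
      φ₀ x * (φ₁ y * φ₂ z + φ₁ z * φ₂ y) + φ₀ y * (φ₁ x * φ₂ z + φ₁ z * φ₂ x) +
        φ₀ z * (φ₁ x * φ₂ y + φ₁ y * φ₂ x) = 0) →
      ∃ κ : ℂ, ∀ x, φ₂ x = κ * (if x = b then φ₁ b else if x = c then -φ₁ c else 0) := by
  intro φ₂ hper
  obtain ⟨hoff, hP⟩ := kernel_of_two_letters φ₀ φ₁ φ₂ a ha h0 hper b c hba hca hbc h1a h1off hnd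
  by_cases hb : φ₁ b = 0
  · -- then `φ₁ c ≠ 0` and `φ₂ b = 0`
    have hc : φ₁ c ≠ 0 := by
      intro hc; apply hnd; rw [hb, hc, mul_zero, mul_zero, add_zero]
    rw [hb, zero_mul, zero_add] at hP
    have h2b : φ₂ b = 0 := (mul_eq_zero.1 hP).resolve_left hc
    refine ⟨-φ₂ c / φ₁ c, fun x => ?_⟩
    by_cases hxb : x = b
    · rw [if_pos hxb, hxb, h2b, hb]; ring
    · rw [if_neg hxb]
      by_cases hxc : x = c
      · rw [if_pos hxc, hxc]; field_simp
      · rw [if_neg hxc, hoff x hxb hxc]; ring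
  · refine ⟨φ₂ b / φ₁ b, fun x => ?_⟩
    by_cases hxb : x = b
    · rw [if_pos hxb, hxb]; field_simp
    · rw [if_neg hxb]
      by_cases hxc : x = c
      · rw [if_pos hxc, hxc]
        field_simp
        linear_combination hP
      · rw [if_neg hxc, hoff x hxb hxc]; ring

end LaplaceResidual

end Summit.ValiantsHypothesis.ValiantsHypothesis.Theorems.RigidityForcesSymmetryRankRigidMinimalRepr
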